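import Literature.MathematicalPhysics.QuantumManyBody.TranslationAveragedDensity
import HarnessLib

/-!
# Route `BECProbeMassFlow`, crux `RecoilTransfer` (stmt-AtomisticToContinuum-12311):
# stub `stub_zeroMomentumAttain`

Support file for the crux `RecoilTransfer` (route `BECProbeMassFlow`, line `registered`, skeleton
`Lines/birth.lean` v3): the stub `stub_zeroMomentumAttain` (exact registered name and signature),
**the mass-deformed tagged ground-state energy is approached inside the sector of total momentum
zero**: for every measurable `v ≥ 0` (hard cores allowed), `0 < L`, every mass ratio `κ` and every
`δ > 0` there is a tagged trial state `Ψ₀` with `HasTotalMomentum 0 Ψ₀.ψ` and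
`⟨Ψ₀, H_κ Ψ₀⟩ ≤ E_κ(N, L) + δ` — WITHOUT Perron–Frobenius theory.

Proof (the method of `BosonicFloor.lean`, with the compact group of simultaneous translations in
place of the finite group of relabellings; the calculus is in
`Literature/…/TranslationAverageCalculus.lean` and `…/TranslationAveragedDensity.lean`). If
`E_κ = ⊤` the constant state does it. Otherwise pick `Ψ` with `⟨Ψ, H_κ Ψ⟩ < E_κ + δ`, average its
DENSITY over the translations, `F(X) = ∫_{[0,L)³} |Ψ(X + t𝟙)|² dt`, and take the regularised root
`g_ε = √(ε² + F) − ε`: it is `C¹`, periodic, bath-symmetric and translation INVARIANT (total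
momentum `0`); by the convexity inequality for gradients and the translation invariance of the
potential its energy density is at most the translation average of that of `Ψ`, so
`𝓔[g_ε] ≤ L³ ⟨Ψ, H_κ Ψ⟩` (`lintegral_energyDensity_sqrtTransAvg_le`, Tonelli and the shift of the
fundamental cell), while `‖g_ε‖² → L³` as `ε = 1/(n+1) → 0`. Normalising `g_ε` for `n` large
(`exists_taggedState_const_mul`, `taggedPeriodicEnergy_const_mul`) gives
`⟨Ψ₀, H_κ Ψ₀⟩ = 𝓔[g_ε]/‖g_ε‖² ≤ L³⟨Ψ, H_κ Ψ⟩/‖g_ε‖² < E_κ + δ` eventually.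
-/

noncomputable section

open MeasureTheory Filter Topology
open scoped ENNReal NNReal

namespace Summit.AtomisticToContinuum.BoseEinsteinCondensation.Theorems

open Literature.MathematicalPhysics.QuantumManyBody.BoseGas

variable {N : ℕ} {L : ℝ}

/-! ### Normalising a tagged function -/

/-- Scaling a wave function scales the mass-deformed kinetic density quadratically:
`taggedKineticDensity κ (c g) X = ‖c‖² taggedKineticDensity κ g X` (at points of
differentiability). [folklore] -/
theorem taggedKineticDensity_const_mul (κ : ℝ) (c : ℂ) {g : Config (N + 1) → ℂ}
    {X : Config (N + 1)} (hg : DifferentiableAt ℝ g X) :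
    taggedKineticDensity κ (fun Y => c * g Y) X =
      ((‖c‖₊ : ℝ≥0∞)) ^ 2 * taggedKineticDensity κ g X := by
  have h : ∀ u : Config (N + 1), ((‖fderiv ℝ (fun Y => c * g Y) X u‖₊ : ℝ≥0∞)) ^ 2 =
      ((‖c‖₊ : ℝ≥0∞)) ^ 2 * ((‖fderiv ℝ g X u‖₊ : ℝ≥0∞)) ^ 2 := fun u => by
    rw [fderiv_const_mul hg c, _root_.smul_apply, smul_eq_mul, nnnorm_mul, ENNReal.coe_mul, mul_pow]
  simp only [taggedKineticDensity_def, h, ← Finset.mul_sum]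
  ring

/-- `∫ ‖c g‖₊² = ‖c‖₊² ∫ ‖g‖₊²` on the cell. [folklore] -/
theorem lintegral_nnnorm_const_mul_sq (c : ℂ) (g : Config (N + 1) → ℂ) :
    ∫⁻ X in cellN (N + 1) L, ((‖c * g X‖₊ : ℝ≥0∞)) ^ 2 =
      ((‖c‖₊ : ℝ≥0∞)) ^ 2 * ∫⁻ X in cellN (N + 1) L, ((‖g X‖₊ : ℝ≥0∞)) ^ 2 := by
  rw [← lintegral_const_mul' _ _ (ENNReal.pow_ne_top ENNReal.coe_ne_top)]
  exact lintegral_congr fun X => by rw [nnnorm_mul, ENNReal.coe_mul, mul_pow]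

/-- `‖(√(I.toReal))⁻¹‖₊² = I⁻¹` for `0 < I < ⊤`. [folklore] -/
theorem nnnorm_inv_sqrt_toReal_sq {I : ℝ≥0∞} (h0 : I ≠ 0) (htop : I ≠ ⊤) :
    ((‖((Real.sqrt I.toReal)⁻¹ : ℂ)‖₊ : ℝ≥0∞)) ^ 2 = I⁻¹ := by
  have hIpos : 0 < I.toReal := ENNReal.toReal_pos h0 htop
  rw [coe_nnnorm_sq_eq_ofReal, norm_inv, Complex.norm_real,
    Real.norm_of_nonneg (Real.sqrt_nonneg _), inv_pow, Real.sq_sqrt hIpos.le,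
    ENNReal.ofReal_inv_of_pos hIpos, ENNReal.ofReal_toReal htop]

/-- **Normalising constructor for tagged states.** A `C¹`, `Lℤ³`-periodic, bath-symmetric `g` on
`(ℝ³)^{N+1}` with `0 < ∫_{cell} |g|² < ∞` yields the admissible tagged state `g/‖g‖`. [folklore] -/
theorem exists_taggedState_const_mul (g : Config (N + 1) → ℂ) (hC : ContDiff ℝ 1 g)
    (hper : ∀ (X : Config (N + 1)) (i : Fin (N + 1)) (k : Fin 3),
      g (X + Pi.single i (EuclideanSpace.single k L)) = g X)
    (hsymm : ∀ σ : Equiv.Perm (Fin (N + 1)), σ 0 = 0 → ∀ X : Config (N + 1), g (X ∘ σ) = g X)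
    (h0 : ∫⁻ X in cellN (N + 1) L, ((‖g X‖₊ : ℝ≥0∞)) ^ 2 ≠ 0)
    (htop : ∫⁻ X in cellN (N + 1) L, ((‖g X‖₊ : ℝ≥0∞)) ^ 2 ≠ ⊤) :
    ∃ Ψ₀ : TaggedPeriodicTrialState N L, Ψ₀.ψ = fun X =>
      ((Real.sqrt (∫⁻ X in cellN (N + 1) L, ((‖g X‖₊ : ℝ≥0∞)) ^ 2).toReal)⁻¹ : ℂ) * g X :=
  ⟨{ ψ := fun X => ((Real.sqrt (∫⁻ X in cellN (N + 1) L, ((‖g X‖₊ : ℝ≥0∞)) ^ 2).toReal)⁻¹ : ℂ) * g X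
     contDiff := contDiff_const.mul hC
     periodic := fun X i k => by rw [hper]
     symm := fun σ hσ X => by rw [hsymm σ hσ]
     norm_eq := by
       rw [lintegral_nnnorm_const_mul_sq, nnnorm_inv_sqrt_toReal_sq h0 htop,
         ENNReal.inv_mul_cancel h0 htop] }, rfl⟩

/-- **Energy of a scaled state**: if `Ψ₀ = c g` with `g` differentiable, then
`⟨Ψ₀, H_κ Ψ₀⟩ = ‖c‖² ∫_{cell} (κ|∇₀g|² + ∑_{j≥1}|∇ⱼg|² + V|g|²)` (both densities are 2-homogeneous).
[folklore] -/
theorem taggedPeriodicEnergy_const_mul (v : ℝ → ℝ≥0∞) (κ : ℝ) {Ψ₀ : TaggedPeriodicTrialState N L}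
    {c : ℂ} {g : Config (N + 1) → ℂ} (hg : Differentiable ℝ g) (h : Ψ₀.ψ = fun X => c * g X) :
    taggedPeriodicEnergy v κ Ψ₀ = ((‖c‖₊ : ℝ≥0∞)) ^ 2 * ∫⁻ X in cellN (N + 1) L,
      (taggedKineticDensity κ g X + taggedInteraction v L X * ((‖g X‖₊ : ℝ≥0∞)) ^ 2) := by
  rw [taggedPeriodicEnergy_def, h,
    ← lintegral_const_mul' _ _ (ENNReal.pow_ne_top ENNReal.coe_ne_top)]
  refine lintegral_congr fun X => ?_
  rw [taggedKineticDensity_const_mul κ c (hg X), nnnorm_mul, ENNReal.coe_mul, mul_pow]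
  ring

/-! ### The energy of the regularised translation average of a tagged state -/

/-- **Pointwise kinetic bound** (convexity inequality for gradients, direction by direction, with
the weight `κ` on the tagged particle): the mass-deformed kinetic density of
`g_ε = √(ε² + ∫_{[0,L)³}|Ψ(· + t𝟙)|²dt) − ε` is at most the translation average of that of `Ψ`.
[folklore] -/
theorem taggedKineticDensity_sqrtTransAvg_le (κ : ℝ) (Ψ : TaggedPeriodicTrialState N L) {ε : ℝ}
    (hε : 0 < ε) (X : Config (N + 1)) :
    taggedKineticDensity κ (fun Y : Config (N + 1) =>
        ((Real.sqrt (ε ^ 2 + ∫ t in cell L, ‖Ψ.ψ (Y + fun _ => t)‖ ^ 2) - ε : ℝ) : ℂ)) X ≤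
      ∫⁻ t in cell L, taggedKineticDensity κ Ψ.ψ (X + fun _ => t) := by
  have hb := fun u => nnnorm_fderiv_sqrtTransAvg_sq_le (L := L) Ψ.contDiff hε X u
  have hm : ∀ u : Config (N + 1), Measurable fun t : Space =>
      ((‖fderiv ℝ Ψ.ψ (X + fun _ => t) u‖₊ : ℝ≥0∞)) ^ 2 := fun u =>
    (((Ψ.contDiff.continuous_fderiv one_ne_zero).comp
      (continuous_const.add continuous_diagConfig)).clm_apply
        continuous_const).measurable.nnnorm.coe_nnreal_ennreal.pow_const _
  have hrhs : ∫⁻ t in cell L, taggedKineticDensity κ Ψ.ψ (X + fun _ => t) =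
      ENNReal.ofReal κ * (∑ k : Fin 3, ∫⁻ t in cell L, ((‖fderiv ℝ Ψ.ψ (X + fun _ => t)
          (Pi.single 0 (EuclideanSpace.single k (1 : ℝ)))‖₊ : ℝ≥0∞)) ^ 2) +
        ∑ j : Fin N, ∑ k : Fin 3, ∫⁻ t in cell L, ((‖fderiv ℝ Ψ.ψ (X + fun _ => t)
          (Pi.single j.succ (EuclideanSpace.single k (1 : ℝ)))‖₊ : ℝ≥0∞)) ^ 2 := by
    simp only [taggedKineticDensity_def]
    rw [lintegral_add_left ((Finset.measurable_sum _ fun k _ => hm _).const_mul _),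
      lintegral_const_mul _ (Finset.measurable_sum _ fun k _ => hm _),
      lintegral_finsetSum _ fun k _ => hm _,
      lintegral_finsetSum _ fun j _ => Finset.measurable_sum _ fun k _ => hm _]
    congr 1
    exact Finset.sum_congr rfl fun j _ => lintegral_finsetSum _ fun k _ => hm _
  rw [hrhs, taggedKineticDensity_def]
  exact add_le_add (mul_le_mul_right (Finset.sum_le_sum fun k _ => hb _) _)
    (Finset.sum_le_sum fun j _ => Finset.sum_le_sum fun k _ => hb _)

/-- **Pointwise potential bound**: `V(X) g_ε(X)² ≤ ∫_{[0,L)³} V(X + t𝟙)|Ψ(X + t𝟙)|² dt`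
(`g_ε² ≤ F` and the tagged potential only sees differences of positions). [folklore] -/
theorem taggedInteraction_mul_sqrtTransAvg_le (v : ℝ → ℝ≥0∞) (Ψ : TaggedPeriodicTrialState N L)
    {ε : ℝ} (hε : 0 < ε) (X : Config (N + 1)) :
    taggedInteraction v L X *
        ((‖((Real.sqrt (ε ^ 2 + ∫ t in cell L, ‖Ψ.ψ (X + fun _ => t)‖ ^ 2) - ε : ℝ) : ℂ)‖₊ :
          ℝ≥0∞)) ^ 2 ≤
      ∫⁻ t in cell L, taggedInteraction v L (X + fun _ => t) *
        ((‖Ψ.ψ (X + fun _ => t)‖₊ : ℝ≥0∞)) ^ 2 := by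
  have hm : Measurable fun t : Space => ((‖Ψ.ψ (X + fun _ => t)‖₊ : ℝ≥0∞)) ^ 2 :=
    (Ψ.contDiff.continuous.comp (continuous_const.add
      continuous_diagConfig)).measurable.nnnorm.coe_nnreal_ennreal.pow_const _
  calc _ ≤ taggedInteraction v L X * ∫⁻ t in cell L, ((‖Ψ.ψ (X + fun _ => t)‖₊ : ℝ≥0∞)) ^ 2 :=
        mul_le_mul_right (nnnorm_sqrtTransAvg_sq_le Ψ.contDiff.continuous hε.le X) _
    _ = ∫⁻ t in cell L, taggedInteraction v L X * ((‖Ψ.ψ (X + fun _ => t)‖₊ : ℝ≥0∞)) ^ 2 :=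
        (lintegral_const_mul _ hm).symm
    _ = _ := by simp only [taggedInteraction_add_const]

/-- **Energy of the regularised translation average.** For measurable `v`, any `κ`, a tagged
state `Ψ` and `ε > 0`,
`∫_{[0,L)^{3(N+1)}} (κ|∇₀g_ε|² + ∑_{j≥1}|∇ⱼg_ε|² + V g_ε²) ≤ L³ · ⟨Ψ, H_κ Ψ⟩`: integrate the
pointwise bounds, swap the integrals (Tonelli) and use that every translate `Ψ(· + t𝟙)` has the
energy of `Ψ` (shift of the fundamental cell). [folklore] -/
theorem lintegral_energyDensity_sqrtTransAvg_le {v : ℝ → ℝ≥0∞} (hv : Measurable v) (κ : ℝ)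
    (Ψ : TaggedPeriodicTrialState N L) {ε : ℝ} (hε : 0 < ε) :
    ∫⁻ X in cellN (N + 1) L,
        (taggedKineticDensity κ (fun Y : Config (N + 1) =>
            ((Real.sqrt (ε ^ 2 + ∫ t in cell L, ‖Ψ.ψ (Y + fun _ => t)‖ ^ 2) - ε : ℝ) : ℂ)) X +
          taggedInteraction v L X *
            ((‖((Real.sqrt (ε ^ 2 + ∫ t in cell L, ‖Ψ.ψ (X + fun _ => t)‖ ^ 2) - ε : ℝ) : ℂ)‖₊ :
              ℝ≥0∞)) ^ 2) ≤
      ENNReal.ofReal L ^ 3 * taggedPeriodicEnergy v κ Ψ := by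
  set D : Config (N + 1) → ℝ≥0∞ := fun X =>
    taggedKineticDensity κ Ψ.ψ X + taggedInteraction v L X * ((‖Ψ.ψ X‖₊ : ℝ≥0∞)) ^ 2 with hD_def
  have hD : Measurable D := (measurable_taggedKineticDensity κ _).add
    ((measurable_taggedInteraction hv L).mul
      ((Ψ.contDiff.continuous.measurable.nnnorm.coe_nnreal_ennreal).pow_const _))
  have hDper : ∀ (X : Config (N + 1)) (i : Fin (N + 1)) (k : Fin 3),
      D (X + Pi.single i (EuclideanSpace.single k L)) = D X := fun X i k => by
    simp only [hD_def, Ψ.taggedKineticDensity_add_single, taggedInteraction_add_single, Ψ.periodic]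
  calc _ ≤ ∫⁻ X in cellN (N + 1) L, ∫⁻ t in cell L, D (X + fun _ => t) := by
        refine lintegral_mono fun X => ?_
        have hmk : Measurable fun t : Space => taggedKineticDensity κ Ψ.ψ (X + fun _ => t) :=
          (measurable_taggedKineticDensity κ Ψ.ψ).comp
            (measurable_const.add continuous_diagConfig.measurable)
        simp only [hD_def]
        rw [lintegral_add_left hmk]
        exact add_le_add (taggedKineticDensity_sqrtTransAvg_le κ Ψ hε X)
          (taggedInteraction_mul_sqrtTransAvg_le v Ψ hε X)
    _ = ENNReal.ofReal L ^ 3 * ∫⁻ X in cellN (N + 1) L, D X :=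
        lintegral_cellN_lintegral_cell_comp_add Ψ.side_pos hD hDper
    _ = ENNReal.ofReal L ^ 3 * taggedPeriodicEnergy v κ Ψ := by rw [taggedPeriodicEnergy_def]

/-! ### The stub -/

/-- **Stub `stub_zeroMomentumAttain` of crux `RecoilTransfer` (route `BECProbeMassFlow`), exact
registered signature: the mass-deformed tagged ground-state energy is approached in the sector of
total momentum `0`.** For measurable `v ≥ 0` (hard cores allowed), `0 < L`, any `κ` and any `δ > 0`
there is a tagged trial state `Ψ₀` of total momentum `0` with `⟨Ψ₀, H_κ Ψ₀⟩ ≤ E_κ(N, L) + δ`: the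
normalised regularised root of the translation-averaged density of a near-minimiser (no
Perron–Frobenius; the constant state if `E_κ = ⊤`). [folklore] -/
theorem stub_zeroMomentumAttain :
    ∀ v : ℝ → ℝ≥0∞, Measurable v → ∀ (N : ℕ) (L : ℝ), 0 < L → ∀ κ : ℝ, ∀ δ : ℝ≥0∞, 0 < δ →
      ∃ Ψ₀ : TaggedPeriodicTrialState N L, HasTotalMomentum 0 Ψ₀.ψ ∧
        taggedPeriodicEnergy v κ Ψ₀ ≤ taggedPeriodicGroundStateEnergy v κ N L + δ := by
  intro v hv N L hL κ δ hδ
  by_cases hE : taggedPeriodicGroundStateEnergy v κ N L = ⊤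
  · refine ⟨TaggedPeriodicTrialState.const N hL, hasTotalMomentum_zero_iff.2 fun _ _ => rfl, ?_⟩
    rw [hE, top_add]
    exact le_top
  obtain ⟨Ψ, hΨ⟩ : ∃ Ψ : TaggedPeriodicTrialState N L,
      taggedPeriodicEnergy v κ Ψ < taggedPeriodicGroundStateEnergy v κ N L + δ :=
    iInf_lt_iff.1 (ENNReal.lt_add_right hE hδ.ne')
  -- the regularised translation averages `g_n`, `ε = 1/(n+1)`, and their norms `I n`
  set I : ℕ → ℝ≥0∞ := fun n => ∫⁻ X in cellN (N + 1) L,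
    ((‖((Real.sqrt ((1 / ((n : ℝ) + 1)) ^ 2 + ∫ t in cell L, ‖Ψ.ψ (X + fun _ => t)‖ ^ 2) -
      (1 / ((n : ℝ) + 1)) : ℝ) : ℂ)‖₊ : ℝ≥0∞)) ^ 2 with hI_def
  have hL3 : ENNReal.ofReal L ^ 3 ≠ 0 := pow_ne_zero _ (ENNReal.ofReal_pos.2 hL).ne'
  have hL3' : ENNReal.ofReal L ^ 3 ≠ ⊤ := ENNReal.pow_ne_top ENNReal.ofReal_ne_top
  have h1top : ∫⁻ X in cellN (N + 1) L, ((‖Ψ.ψ X‖₊ : ℝ≥0∞)) ^ 2 ≠ ⊤ := by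
    rw [Ψ.norm_eq]; exact ENNReal.one_ne_top
  have hI : Tendsto I atTop (𝓝 (ENNReal.ofReal L ^ 3)) := by
    have h := tendsto_lintegral_nnnorm_sqrtTransAvg_sq hL Ψ.contDiff Ψ.periodic h1top
    rwa [Ψ.norm_eq, mul_one] at h
  have hItop : ∀ n, I n ≠ ⊤ := fun n =>
    ne_top_of_le_ne_top (ENNReal.mul_ne_top hL3' h1top)
      (lintegral_nnnorm_sqrtTransAvg_sq_le hL Ψ.contDiff.continuous Ψ.periodic
        Nat.one_div_pos_of_nat.le)
  -- eventually `0 < I n` and `(I n)⁻¹ L³ ⟨Ψ, H_κ Ψ⟩ < E_κ + δ`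
  have hev1 : ∀ᶠ n in atTop, 0 < I n := hI.eventually_const_lt (pos_iff_ne_zero.2 hL3)
  have hlim : Tendsto (fun n => (I n)⁻¹ * (ENNReal.ofReal L ^ 3 * taggedPeriodicEnergy v κ Ψ))
      atTop (𝓝 ((ENNReal.ofReal L ^ 3)⁻¹ * (ENNReal.ofReal L ^ 3 * taggedPeriodicEnergy v κ Ψ))) :=
    ENNReal.Tendsto.mul_const (tendsto_inv_iff.2 hI) (Or.inl (ENNReal.inv_ne_zero.2 hL3'))
  rw [← mul_assoc, ENNReal.inv_mul_cancel hL3 hL3', one_mul] at hlim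
  obtain ⟨n, hn0, hn⟩ := (hev1.and (hlim.eventually_lt_const hΨ)).exists
  -- the normalised state `g_n / ‖g_n‖`
  have hε : (0 : ℝ) < 1 / ((n : ℝ) + 1) := Nat.one_div_pos_of_nat
  have hgC := contDiff_sqrtTransAvg (L := L) Ψ.contDiff hε
  obtain ⟨Ψ₀, hΨ₀⟩ := exists_taggedState_const_mul _ hgC
    (fun X i k => sqrtTransAvg_add_single Ψ.periodic _ X i k)
    (fun σ hσ X => sqrtTransAvg_comp_perm (Ψ.symm σ hσ) _ X) hn0.ne' (hItop n)
  refine ⟨Ψ₀, ?_, ?_⟩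
  · rw [hΨ₀]
    exact (hasTotalMomentum_zero_sqrtTransAvg hL Ψ.contDiff.continuous Ψ.periodic _).const_mul _
  · rw [taggedPeriodicEnergy_const_mul v κ (hgC.differentiable one_ne_zero) hΨ₀,
      nnnorm_inv_sqrt_toReal_sq hn0.ne' (hItop n)]
    exact (mul_le_mul_right (lintegral_energyDensity_sqrtTransAvg_le hv κ Ψ hε) _).trans hn.le

end Summit.AtomisticToContinuum.BoseEinsteinCondensation.Theorems

end
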